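import Summits.ResolutionOfSingularities.ResolutionOfSingularities.Theorems.RadicialJungCleanModelsF75cSupportDecomposition
import Literature.AlgebraicGeometry.Resolution.ArithmeticalThreefoldsBlowupFormDimThree
import Literature.AlgebraicGeometry.Resolution.EmbeddedResolution
import Literature.AlgebraicGeometry.Resolution.BlowupsFlatBaseChange
import Literature.AlgebraicGeometry.Resolution.EmbeddedResolutionCurvesInSurfaces
import HarnessLib

/-!
# [F-75c discharge, ASSEMBLY for integral surfaces] Stacks Project Lemma 54.15.6 = Tag 0BIC with the locus of the
# centres (F-75c), for an INTEGRAL Noetherian regular excellent scheme of dimension `≤ 2`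

Cell res-hironaka, D-0154 INPUTS discharger `res-inputs-p-f75c` for the named fact F-75c
`Literature.AlgebraicGeometry.Resolution.Stacks0BIC_embeddedResolutionCurvesInSurfaces_locus`
(`--supports stmt-ResolutionOfSingularities-15917 --as helper`). **`F75c.stacks0BIC_locus_of_isIntegral`** — for `X`
INTEGRAL, Noetherian, with regular local rings, excellent, `dim X ≤ 2`, and an ideal sheaf `Z` with nowhere dense
support: there is a composition `π : X' → X` of blowing ups in closed points lying over `V(Z)` such that `Z·𝒪_{X'}` is an
effective Cartier divisor and `π⁻¹V(Z)` is a strict normal crossings divisor. Assembly (E-first form of the printed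
proof): Cartier step `π₁` (brick P3, Tags 0AHH/0BIB) — decomposition of `V(Z·𝒪_{X₁})` into members and isolated points
(A1) — blow up bad points (L1) — blow up triple points (L2) — the end configuration is snc (L3 + brick (v)); Cartier
persists and loci compose (A1). What is NOT covered here: F-75c's `X` is only Noetherian with regular local rings (a
finite disjoint union of integral components); the reduction to the integral case is the remaining brick.

HONEST FRAMING: kernel bookkeeping of a printed theorem over this seat's bricks and the tree; nothing here is a statement
of [Hironaka2017]; no summit statement is proved. AI-written; AI review is weaker than expert review.
References: The Stacks Project, Tags 0BIC, 0BIB, 0AHH, 0BI7, 0BIA [StacksProject].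
-/

noncomputable section

set_option linter.dupNamespace false -- mandated namespace of this single-conjunct summit

open CategoryTheory AlgebraicGeometry TopologicalSpace IsLocalRing

namespace Summit.ResolutionOfSingularities.ResolutionOfSingularities.Theorems

namespace F75c

open Literature.AlgebraicGeometry.Resolution
open Scheme.IdealSheafData

universe u

/-- **Stacks Project Lemma 54.15.6 (Tag 0BIC) with the locus of the centres — integral case.** For an integral
Noetherian scheme `X` with regular local rings, excellent, of dimension `≤ 2`, and an ideal sheaf `Z` whose support is
nowhere dense, there are `X'` and a composition `π : X' → X` of blowing ups at closed points lying over `V(Z)` such that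
`Z·𝒪_{X'}` is an effective Cartier divisor and `π⁻¹V(Z)` is a strict normal crossings divisor on `X'`.
[cite: StacksProject, Tag 0BIC (Lemma 54.15.6)] [cite: StacksProject, Tag 0BIB (Lemma 54.15.5)]
[cite: StacksProject, Tag 0AHH (Lemma 54.4.1)] -/
theorem stacks0BIC_locus_of_isIntegral (X : Scheme.{u}) [IsIntegral X] [IsNoetherian X] (Z : X.IdealSheafData)
    (hreg : Scheme.IsRegular X) (hexc : Scheme.IsExcellent X) (hdim : topologicalKrullDim X ≤ 2)
    (hZ : IsNowhereDense (Z.support : Set X)) :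
    ∃ (X' : Scheme.{u}) (π : X' ⟶ X), IsPointBlowupComposition (Z.support : Set X) π ∧
      IsEffectiveCartier (Z.comap π) ∧ IsStrictNormalCrossingsDivisor X' (π ⁻¹' (Z.support : Set X)) := by
  classical
  -- `Z ≠ 0`
  have hZ0 : Z ≠ ⊥ := by
    intro h
    have huniv : (Z.support : Set X) = Set.univ := by rw [h, Scheme.IdealSheafData.support_bot]; rfl
    have hint : interior (closure (Z.support : Set X)) = ∅ := hZ
    rw [huniv, closure_univ, interior_univ] at hint
    exact (Set.univ_eq_empty_iff.mp hint).false (genericPoint X)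
  -- (1) Cartier step
  obtain ⟨X₁, π₁, hIPC₁, hlp⟩ := exists_isPointBlowupComposition_isLocallyPrincipal X hreg hexc hdim Z
  obtain ⟨hN₁, hreg₁, hexc₁, hdim₁⟩ := IsPointBlowupComposition.invariants hIPC₁ hreg hexc hdim
  haveI := hN₁
  haveI : IsIntegral X₁ := hIPC₁.isIntegral inferInstance
  have hcart₁ : IsEffectiveCartier (Z.comap π₁) :=
    hlp.isEffectiveCartier_of_ne_bot (IsPointBlowupComposition.comap_ne_bot hIPC₁ hZ0)
  -- (2) decomposition of `V(Z·𝒪_{X₁})` into members and isolated points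
  obtain ⟨𝒞₀, P, hfin₀, hPfin, hmem₀, hPcl, hP1, hPoff, hS₁⟩ := exists_members_decomposition hreg₁ hdim₁ hcart₁
  -- (3) bad points, then (4) triple points
  obtain ⟨Y₂, σ₂, 𝒞₂, hIPC₂, hfin₂, hmem₂, hU₂, hno₂⟩ := exists_noBadPoint X₁ hreg₁ hexc₁ hdim₁ 𝒞₀ hfin₀ hmem₀
  obtain ⟨hregC₂, htr₂⟩ := good_of_noBadPoint hno₂
  obtain ⟨Y₃, σ₃, 𝒞₃, hIPC₃, hfin₃, hmem₃, hU₃, hregC₃, htr₃, hnt₃⟩ :=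
    exists_good_noTriplePoint hreg₁ hexc₁ hdim₁ σ₂ 𝒞₂ hIPC₂ hfin₂ hmem₂ hU₂ hregC₂ htr₂
  obtain ⟨hN₃, hreg₃, hexc₃, hdim₃⟩ := IsPointBlowupComposition.invariants hIPC₃ hreg₁ hexc₁ hdim₁
  haveI := hN₃
  -- the isolated points upstairs: `σ₃` is an isomorphism near them
  set M : Set X₁ := ⋃ C ∈ 𝒞₀, (C : Set X₁) with hM
  have hMcl : IsClosed M := hfin₀.isClosed_biUnion fun C _ => C.isClosed
  set V : X₁.Opens := ⟨Mᶜ, hMcl.isOpen_compl⟩ with hV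
  haveI hiso : IsIso (σ₃ ∣_ V) := hIPC₃.isIso_morphismRestrict V (Set.disjoint_compl_left_iff_subset.mpr subset_rfl)
  have hPV : ∀ p ∈ P, p ∈ V := fun p hp hpM => by
    rw [hM, Set.mem_iUnion₂] at hpM
    obtain ⟨C, hC, hpC⟩ := hpM
    exact hPoff p hp C hC hpC
  have huniq : ∀ q : Y₃, σ₃ q ∈ P → ∀ q' : Y₃, σ₃ q' = σ₃ q → q' = q := by
    intro q hq q' hq'
    obtain ⟨q₀, -, hq₀⟩ := existsUnique_preimage_of_isIso_morphismRestrict σ₃ hiso (hPV _ hq)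
    exact (hq₀ q' hq').trans (hq₀ q rfl).symm
  have hP₃fin : (σ₃ ⁻¹' P).Finite :=
    hPfin.preimage fun q₁ h₁ q₂ h₂ h12 => huniq q₂ h₂ q₁ h12
  have hP₃cl : ∀ q ∈ σ₃ ⁻¹' P, IsClosed ({q} : Set Y₃) := by
    intro q hq
    have heq : ({q} : Set Y₃) = σ₃ ⁻¹' {σ₃ q} := by
      ext q'
      simp only [Set.mem_singleton_iff, Set.mem_preimage]
      exact ⟨fun h => by rw [h], fun h => huniq q hq q' h⟩
    rw [heq]
    exact (hPcl _ hq).preimage σ₃.continuous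
  have hP₃1 : ∀ q ∈ σ₃ ⁻¹' P, ringKrullDim (Y₃.presheaf.stalk q) = 1 := by
    intro q hq
    haveI := isIso_stalkMap_of_isIso_morphismRestrict σ₃ V q (hPV _ hq)
    rw [← hP1 _ hq]
    exact ringKrullDim_eq_of_ringEquiv (asIso (σ₃.stalkMap q)).commRingCatIsoToRingEquiv.symm
  have hP₃off : ∀ q ∈ σ₃ ⁻¹' P, ∀ C ∈ 𝒞₃, q ∉ (C : Set Y₃) := by
    intro q hq C hC hqC
    have : q ∈ σ₃ ⁻¹' M := by rw [← hU₃]; exact Set.mem_biUnion hC hqC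
    exact hPV _ hq this
  have hsnc := isStrictNormalCrossingsDivisor_of_good hreg₃ hexc₃.isQuasiExcellent hdim₃ hfin₃ hmem₃ hregC₃ htr₃ hnt₃
    hP₃fin hP₃cl hP₃1 hP₃off
  -- assemble
  refine ⟨Y₃, σ₃ ≫ π₁, ?_, ?_, ?_⟩
  · refine (hIPC₁.mono (nonPrincipalLocus_le_support Z)).comp (T₁ := M) ?_ hIPC₃
    rintro _ ⟨y, hy, rfl⟩
    have hy' : y ∈ ((Z.comap π₁).support : Set X₁) := by rw [hS₁]; exact Or.inl hy
    rwa [Scheme.IdealSheafData.support_comap] at hy'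
  · rw [Scheme.IdealSheafData.comap_comp]
    exact IsPointBlowupComposition.isEffectiveCartier_comap hIPC₃ hcart₁
  · have hpre : (σ₃ ≫ π₁) ⁻¹' (Z.support : Set X) = (⋃ C ∈ 𝒞₃, (C : Set Y₃)) ∪ σ₃ ⁻¹' P := by
      rw [Scheme.Hom.comp_base, TopCat.coe_comp, Set.preimage_comp, hU₃]
      have : π₁ ⁻¹' (Z.support : Set X) = ((Z.comap π₁).support : Set X₁) := by
        rw [Scheme.IdealSheafData.support_comap]; rfl
      rw [this, hS₁, Set.preimage_union]
    rw [hpre]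
    exact hsnc

end F75c

end Summit.ResolutionOfSingularities.ResolutionOfSingularities.Theorems

end
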